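import Summits.QuantumFields.YangMills.Theorems.BalabanUVNodesN15KingModelFullPropagatorL2SecondOrderLetters
import HarnessLib

/-!
# BalabanUVNodes ∕ N15 — THE KING-MODEL RUNG, CURVED EDITION (PART Υ-b′): [B9] (3.46) AT `U ≡ 1`, THE FIFTH ENTRY `‖h·∇_μ∇_νA₀⁻¹λ‖ ≤ C·|h|_∞·e^{−δ|b − b′|}·‖λ‖`
# for King's full `A = 0` propagator — the second-order `L²` member by `L²` INTERIOR REGULARITY on the torus, UNIFORMLY in `K`, the volume and the mass
# (Track A, DAG node N15 = NE2; FAN-OUT v1.1 §N15 s3 «KING-MODEL RUNG … + the one-line statement of what the curved case adds»)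

HONEST FRAMING.  Count-neutral operator bookkeeping (cell `pub-ymgap`, seat `pub-ymgap-dag-n15-e` g17; `--supports stmt-QuantumFields-27366 --as helper` =
K3⁸ `SpineGivenEndpointR13SepCoPHV`).  TEMPLATE LITERATURE, `A = 0`: C. King's scalar U(1)-Higgs MODEL on finite tori ([King1986] (2.13) p. 653, (4.1)–(4.5)
p. 670), NOT Bałaban's covariant objects.  [Balaban1985BackgroundPropagators] Thm 3.1 (3.46) p. 398, fifth entry: «`‖h∇_U∇_UG′(U)λ‖ ≤ B₀·1·|h|e^{−δ₀d(y,y′)}‖λ‖`,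
`supp h ⊂ Δ̃(y)`, `supp λ ⊂ Δ(y′)`».  At `U ≡ 1`, for King's full `A = 0` propagator `A₀⁻¹ = (N²(−Δ) + m² + a_KQ*Q)⁻¹`, part Ξ-b (`…FullPropagatorL2LocalMixed`,
HONEST SCOPE (iv)) left entries 5–6 open: the kernel `∇_μ∇_νA₀⁻¹(·, z)` has NO uniform sup majorant (for `μ ≠ ν` it is logarithmic at the edges of the
`Q*Q` blocks, where `Q*QA₀⁻¹λ` jumps), so neither Schur's test (Ξ-a∕Ξ-b) nor a kernel letter (the g10 desk's «after an ∂∂ℋ bound») serves (a DIAGNOSIS, not typed; the road below needs no kernel bound).  THE ROAD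
HERE: `L²` interior regularity — part Υ-a's torus `H²` identity `Σ(∂_μ∂_νv)² ≤ Σ(Δv)²` applied to `v = χ_b·u`, `u = A₀⁻¹λ`, with part Υ-a′'s `C^{1,1}` block
cut-off `χ_b` (plateau ⊇ `b` and its forward steps, support ⊂ blocks at sup-distance `≤ 2`, `|N∂χ_b| ≤ π`, `|N²Δχ_b| ≤ 16π⁴(d+1)`), the product rule,
THE EQUATION `N²Δu = m²u + a_KQ*Qu − λ` (part Q4b `lap_inv_mulVec_eq`), and part Ξ-a's localised members (3.46)₁,₂ (`fullPropOp_l2_local`,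
`fullPropDOp_l2_local`) on the `≤ 5^{d+1}` blocks under the cut-off; the two-block volume `2L^0` (where the cut-off has no room) by part X's GLOBAL bound
`fullPropOps_l2_unif` (all block distances are `≤ 1` there).  Decided in the MODEL; NOT the printed proposition (covariant `G(U)`, `Reg335`, multiscale
sites); NE2⁺ is NOT PRINTED and not proved; NOT a node discharge; nothing continuum ∕ ℝ⁴ ∕ OS ∕ mass-gap ∕ Clay.  0 `sorry`, 0 `def`, standard axioms.
* (letters: part Υ-b `…FullPropagatorL2SecondOrderLetters` — the equation squared, the global bound, the near-block bookkeeping, the product rule summed,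
  the near-indicator domination of the cut-off letters)
* ★★ **`fullPropHessOp_l2_local`** — `∃ C δ > 0 ∀ K ≥ 1 ∀ N = L^K ∀ cube 2L^e ∀ 0 < m² ≤ m₀² ∀ μ ν λ h H_h b b′` (cut-off in `b`, source in `b′`):
  `Σ_x (h(x)·N²(u(x+e_μ+e_ν) − u(x+e_μ) − u(x+e_ν) + u(x)))² ≤ (C·H_h·e^{−δ|b−b′|})²·Σ_zλ(z)²`, `u = A₀⁻¹λ`.
WHAT THE CURVED CASE ADDS (one line): (3.46)₅ itself for `G(U)` over `Reg335` with the multiscale sites — [B9]'s random-walk expansion (N06's row), untouched.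
HONEST SCOPE.  (i) `A = 0`, periodic b.c., odd `L ≥ 3`, cubes `2L^e` (every `e ≥ 0`), `K ≥ 1`, `0 < m² ≤ m₀²`; (ii) King's spelling: plain `ℓ²` sums, forward
η-differences `N(f(· + e_μ) − f)`; (iii) single-block cut-off ∕ source; (iv) entry 6 (`hG∇*∇*λ`) is part Υ-c `…L2LocalSecondOrderSix` (this entry transposed); (v) not Bałaban's `G(U)`; not a discharge.
Locators: [Balaban1985BackgroundPropagators] Thm 3.1 (3.46)–(3.47) p. 398; [King1986] (2.13) p. 653, (4.1)–(4.5) p. 670, (4.36) p. 674; [Balaban1984PropagatorsII] (2.36) p. 229.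
-/

noncomputable section

namespace Summit.QuantumFields.YangMills.BalabanUVNodes.N15KingModelRung.Curved

open Real Finset Matrix
open Literature.MathematicalPhysics.QuantumFieldTheory.Balaban1983to89.B4Sect5Proof (latticeConst latticeConst_nonneg)
open Literature.MathematicalPhysics.QuantumFieldTheory.Balaban1983to89.B4TorusKernel.MultiPeriod (circAbs)
open Literature.MathematicalPhysics.QuantumFieldTheory.Balaban1983to89.B5Prop11Plancherel (Tor fine unitVec)
open Literature.MathematicalPhysics.QuantumFieldTheory.King1986 (aK aK_pos aK_le)
open Literature.MathematicalPhysics.QuantumFieldTheory.King1986.Torus (fineOp blockOf blockProj tdistT tdistT_nonneg tdistT_symm tdistT_self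
  tdistT_triangle tdistT_sumBound tdistT_le_of_coord)
open Summit.QuantumFields.YangMills.BalabanUVNodes.N15.KingModel (fwdDiff adjDiff lapOp fwdDiff_apply lapOp_apply)
open Summit.QuantumFields.YangMills.BalabanUVNodes.N15.Gluing (bcube)

variable {d : ℕ} (L : ℕ) [NeZero L]

/-! ## The fifth (3.46) entry, localised -/

/-- ★★ **ENTRY 5 OF (3.46) AT `U ≡ 1`, LOCALISED — `‖h·∇_μ∇_νA₀⁻¹λ‖ ≤ C·|h|_∞·e^{−δ|b−b′|}·‖λ‖`**: for odd `L ≥ 3`, `a > 0` and a mass cap `m₀² ≥ 0` there are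
`C, δ > 0` such that for EVERY `K ≥ 1` (`N = L^K`), cube `M_μ = 2L^e`, mass `0 < m² ≤ m₀²`, directions `μ, ν`, source `λ` supported in the block `b′`
and cut-off `h` supported in the block `b` with `|h| ≤ H_h`:
`Σ_x (h(x)·N²·(u(x+e_μ+e_ν) − u(x+e_μ) − u(x+e_ν) + u(x)))² ≤ (C·H_h·e^{−δ|b−b′|})²·Σ_z λ(z)²`, `u = A₀⁻¹λ` — by `L²` interior regularity (module
docstring).  [B9]'s prefactor for this entry is `1` (no powers of `L^jη`): the two derivatives eat the two powers of the spacing.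
[cite: Balaban1985BackgroundPropagators, Thm 3.1 (3.46) p.398 (fifth entry, shape); King1986, (2.13) p.653, (4.1)–(4.5) p.670; Balaban1984PropagatorsII, (2.36) p.229] -/
theorem fullPropHessOp_l2_local (hLodd : Odd L) (hL : 2 ≤ L) {a : ℝ} (ha : 0 < a) {m0sq : ℝ} (hm0 : 0 ≤ m0sq) :
    ∃ C δ : ℝ, 0 < C ∧ 0 < δ ∧ ∀ (K : ℕ), 1 ≤ K → ∀ (N : ℕ) [NeZero N], N = L ^ K →
      ∀ (e : ℕ) (M : Fin (d + 1) → ℕ) [∀ μ, NeZero (M μ)], (∀ μ, M μ = 2 * L ^ e) →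
      ∀ (msq : ℝ), 0 < msq → msq ≤ m0sq → ∀ (μ ν : Fin (d + 1)) (lam h : Tor (fine N M) → ℝ) (Hh : ℝ) (b b' : Tor M), 0 ≤ Hh →
        (∀ x, |h x| ≤ Hh) → (∀ x, h x ≠ 0 → blockOf N M x = b) → (∀ z, lam z ≠ 0 → blockOf N M z = b') →
        ∑ x, (h x * ((N : ℝ) ^ 2 *
            (((fineOp N M (aK a L K) (((N : ℕ) : ℝ) ^ 2) msq)⁻¹ *ᵥ lam) (x + unitVec (fine N M) μ + unitVec (fine N M) ν)
              - ((fineOp N M (aK a L K) (((N : ℕ) : ℝ) ^ 2) msq)⁻¹ *ᵥ lam) (x + unitVec (fine N M) μ)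
              - ((fineOp N M (aK a L K) (((N : ℕ) : ℝ) ^ 2) msq)⁻¹ *ᵥ lam) (x + unitVec (fine N M) ν)
              + ((fineOp N M (aK a L K) (((N : ℕ) : ℝ) ^ 2) msq)⁻¹ *ᵥ lam) x))) ^ 2
          ≤ (C * Hh * Real.exp (-(δ * tdistT M b b'))) ^ 2 * ∑ z, lam z ^ 2 := by
  classical
  have hL3 : 3 ≤ L := by
    obtain ⟨k, hk⟩ := hLodd
    omega
  have hL1 : (1 : ℝ) < L := by exact_mod_cast (show 1 < L by omega)
  obtain ⟨C₁, δ₁, hC₁, hδ₁, H₁⟩ := fullPropOp_l2_local (d := d) L hLodd hL ha hm0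
  obtain ⟨C₂, δ₂, hC₂, hδ₂, H₂⟩ := fullPropDOp_l2_local (d := d) L hLodd hL ha hm0
  obtain ⟨Cg, hCg, Hg⟩ := fullPropHessOp_l2_global (d := d) L hL ha m0sq
  set δ : ℝ := min δ₁ δ₂ with hδdef
  have hδ : 0 < δ := lt_min hδ₁ hδ₂
  have hdle₁ : δ ≤ δ₁ := min_le_left _ _
  have hdle₂ : δ ≤ δ₂ := min_le_right _ _
  set Λ₁ : ℝ := latticeConst (d + 1) 1 with hΛ₁
  have hΛ₁0 : 0 ≤ Λ₁ := latticeConst_nonneg (d + 1) zero_le_one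
  set A₁ : ℝ := Real.exp 2 * Λ₁ * (C₁ * Real.exp (2 * δ₁)) ^ 2 with hA₁
  set A₂ : ℝ := Real.exp 2 * Λ₁ * (C₂ * Real.exp (2 * δ₂)) ^ 2 with hA₂
  set B : ℝ := 9 * (m0sq ^ 2 + a ^ 2) * A₁ + 9 * Real.exp (4 * δ) + 3 * (16 * π ^ 4 * (d + 1)) ^ 2 * A₁
    + 12 * (d + 1) * ((d + 1) * (π ^ 2 * A₂)) with hB
  have hA₁0 : 0 ≤ A₁ := by positivity
  have hA₂0 : 0 ≤ A₂ := by positivity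
  have hB0 : 0 ≤ B := by positivity
  set Bg : ℝ := Cg ^ 2 * Real.exp (2 * δ) with hBg
  have hBg0 : 0 ≤ Bg := by positivity
  have hBtot : 0 < B + Bg := by positivity
  refine ⟨Real.sqrt (B + Bg), δ, Real.sqrt_pos.mpr hBtot, hδ, ?_⟩
  intro K hK N _ hN e M _ hM msq hmsq hcap μ ν lam h Hh b b' hHh hh hsh hsl
  set u := (fineOp N M (aK a L K) (((N : ℕ) : ℝ) ^ 2) msq)⁻¹ *ᵥ lam with hu
  set S := ∑ z, lam z ^ 2 with hSdef
  have hS : 0 ≤ S := Finset.sum_nonneg fun z _ => sq_nonneg _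
  set D := tdistT M b b' with hDdef
  have hD : 0 ≤ D := tdistT_nonneg M b b'
  have hN3 : 3 ≤ N := by
    rw [hN]
    calc 3 ≤ L := hL3
      _ = L ^ 1 := (pow_one L).symm
      _ ≤ L ^ K := Nat.pow_le_pow_right (by omega) hK
  have hNr : (0 : ℝ) < N := by exact_mod_cast (show 0 < N by omega)
  -- the target's left side through `h² ≤ H_h²`
  have hExp : Real.sqrt (B + Bg) ^ 2 = B + Bg := Real.sq_sqrt hBtot.le
  -- STEP 0: `Σ (h·X)² ≤ H_h²·Σ X²` for any `X`
  have hhsq : ∀ X : Tor (fine N M) → ℝ, ∑ x, (h x * X x) ^ 2 ≤ Hh ^ 2 * ∑ x, (X x) ^ 2 := by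
    intro X
    rw [Finset.mul_sum]
    refine Finset.sum_le_sum fun x _ => ?_
    rw [mul_pow]
    exact mul_le_mul_of_nonneg_right (by have := hh x; exact sq_le_sq' (abs_le.mp this).1 (abs_le.mp this).2) (sq_nonneg _)
  by_cases he : e = 0
  · -- the two-block volume: the global bound, every block distance `≤ 1`
    subst he
    have hM2 : ∀ μ', M μ' = 2 := fun μ' => by rw [hM μ']; ring
    have hD1 : D ≤ 1 := tdistT_le_one_of_two M hM2 b b'
    have hglob := Hg K hK N hN M msq hmsq hcap μ ν lam
    rw [← hu] at hglob
    have hrew : ∀ x, h x * ((N : ℝ) ^ 2 * (u (x + unitVec (fine N M) μ + unitVec (fine N M) ν) - u (x + unitVec (fine N M) μ)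
        - u (x + unitVec (fine N M) ν) + u x)) = h x * ((N : ℝ) ^ 2 * N15.KingModel.fwdDiff (fine N M) μ (N15.KingModel.fwdDiff (fine N M) ν u) x) := by
      intro x; rw [fwdDiff_fwdDiff_apply]
    rw [Finset.sum_congr rfl fun x _ => by rw [hrew x]]
    refine (hhsq _).trans ?_
    refine (mul_le_mul_of_nonneg_left hglob (sq_nonneg _)).trans ?_
    rw [show (Real.sqrt (B + Bg) * Hh * Real.exp (-(δ * D))) ^ 2 * S = Hh ^ 2 * ((B + Bg) * Real.exp (-(δ * D)) ^ 2 * S) by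
      rw [mul_pow, mul_pow, hExp]; ring]
    refine mul_le_mul_of_nonneg_left ?_ (sq_nonneg _)
    have hone : 1 ≤ Real.exp (2 * δ) * Real.exp (-(δ * D)) ^ 2 := by
      rw [sq, ← Real.exp_add, ← Real.exp_add]
      refine Real.one_le_exp ?_
      have : δ * D ≤ δ * 1 := mul_le_mul_of_nonneg_left hD1 hδ.le
      linarith
    have h1 : Cg ^ 2 ≤ Bg * Real.exp (-(δ * D)) ^ 2 := by
      rw [hBg, mul_assoc]
      exact le_mul_of_one_le_right (sq_nonneg _) hone
    have h2 : Bg * Real.exp (-(δ * D)) ^ 2 ≤ (B + Bg) * Real.exp (-(δ * D)) ^ 2 :=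
      mul_le_mul_of_nonneg_right (le_add_of_nonneg_left hB0) (sq_nonneg _)
    calc Cg ^ 2 * S ≤ Bg * Real.exp (-(δ * D)) ^ 2 * S := mul_le_mul_of_nonneg_right h1 hS
      _ ≤ (B + Bg) * Real.exp (-(δ * D)) ^ 2 * S := mul_le_mul_of_nonneg_right h2 hS
  · -- cubes `2L^e`, `e ≥ 1`: the cut-off road
    have he1 : 1 ≤ e := Nat.one_le_iff_ne_zero.mpr he
    set Kc : ℕ := 2 * L ^ e with hKc
    have hKc6 : 6 ≤ Kc := by
      have : L ≤ L ^ e := by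
        calc L = L ^ 1 := (pow_one L).symm
          _ ≤ L ^ e := Nat.pow_le_pow_right (by omega) he1
      omega
    have hKc0 : 0 < Kc := by omega
    set χ := bcube Kc (fun ν (x : Tor (fine N M)) => (((x ν).val : ℕ) : ℝ) / N - (1 + 1 / (N : ℝ)) / 2) 1 (fun ν => (((b ν).val : ℕ) : ZMod Kc)) with hχdef
    set ω : Tor (fine N M) → ℝ := fun x => if tdistT M b (blockOf N M x) ≤ 2 then 1 else 0 with hωdef
    have hω0 : ∀ x, 0 ≤ ω x := fun x => by rw [hωdef]; dsimp only; split_ifs <;> norm_num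
    -- STEP 1: insert the cut-off (plateau)
    have hins : ∀ x, h x * ((N : ℝ) ^ 2 * (u (x + unitVec (fine N M) μ + unitVec (fine N M) ν) - u (x + unitVec (fine N M) μ)
        - u (x + unitVec (fine N M) ν) + u x))
        = h x * ((N : ℝ) ^ 2 * N15.KingModel.fwdDiff (fine N M) μ (N15.KingModel.fwdDiff (fine N M) ν (fun z => χ z * u z)) x) := by
      intro x
      by_cases hx : h x = 0
      · rw [hx, zero_mul, zero_mul]
      · have hb : blockOf N M x = b := hsh x hx
        have c0 : χ x = 1 := blockBump_eq_one_of_blockOf_eq hM hKc0 hb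
        have c1 : χ (x + unitVec (fine N M) μ) = 1 := blockBump_add_eq_one_of_blockOf_eq hM hKc0 hb μ
        have c2 : χ (x + unitVec (fine N M) ν) = 1 := blockBump_add_eq_one_of_blockOf_eq hM hKc0 hb ν
        have c3 : χ (x + unitVec (fine N M) μ + unitVec (fine N M) ν) = 1 := blockBump_add_add_eq_one_of_blockOf_eq hM hKc0 hb μ ν
        rw [fwdDiff_fwdDiff_apply, c0, c1, c2, c3, one_mul, one_mul, one_mul, one_mul]
    rw [Finset.sum_congr rfl fun x _ => by rw [hins x]]
    refine (hhsq _).trans ?_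
    -- STEP 2: the `H²` identity
    have hH2 : ∑ x, ((N : ℝ) ^ 2 * N15.KingModel.fwdDiff (fine N M) μ (N15.KingModel.fwdDiff (fine N M) ν (fun z => χ z * u z)) x) ^ 2
        ≤ ∑ x, ((N : ℝ) ^ 2 * lapOp (fine N M) (fun z => χ z * u z) x) ^ 2 := by
      have h := sum_sq_fwdDiff_fwdDiff_le_sum_sq_lapOp (fine N M) μ ν (fun z => χ z * u z)
      have hN4 : (0 : ℝ) ≤ ((N : ℝ) ^ 2) ^ 2 := sq_nonneg _
      have e1 : ∑ x, ((N : ℝ) ^ 2 * N15.KingModel.fwdDiff (fine N M) μ (N15.KingModel.fwdDiff (fine N M) ν (fun z => χ z * u z)) x) ^ 2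
          = ((N : ℝ) ^ 2) ^ 2 * ∑ x, (N15.KingModel.fwdDiff (fine N M) μ (N15.KingModel.fwdDiff (fine N M) ν (fun z => χ z * u z)) x) ^ 2 := by
        rw [Finset.mul_sum]; exact Finset.sum_congr rfl fun x _ => mul_pow _ _ 2
      have e2 : ∑ x, ((N : ℝ) ^ 2 * lapOp (fine N M) (fun z => χ z * u z) x) ^ 2
          = ((N : ℝ) ^ 2) ^ 2 * ∑ x, (lapOp (fine N M) (fun z => χ z * u z) x) ^ 2 := by
        rw [Finset.mul_sum]; exact Finset.sum_congr rfl fun x _ => mul_pow _ _ 2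
      rw [e1, e2]
      exact mul_le_mul_of_nonneg_left h hN4
    refine (mul_le_mul_of_nonneg_left hH2 (sq_nonneg _)).trans ?_
    -- STEP 3: the product rule, squared and summed
    refine (mul_le_mul_of_nonneg_left (sum_sq_lapOp_mul_le (N : ℝ) χ u) (sq_nonneg _)).trans ?_
    -- STEP 4: the letters: near-indicator domination, the equation
    have hletters := fun x => blockBump_letters_le_near N M hM hKc6 hN3 b x
    have hpt : ∀ x, 3 * (χ x) ^ 2 * ((N : ℝ) ^ 2 * lapOp (fine N M) u x) ^ 2 + 3 * (u x) ^ 2 * ((N : ℝ) ^ 2 * lapOp (fine N M) χ x) ^ 2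
          + 12 * (d + 1) * ∑ ρ, ((N : ℝ) * (χ (x + unitVec (fine N M) ρ) - χ x)) ^ 2 * ((N : ℝ) * (u (x + unitVec (fine N M) ρ) - u x)) ^ 2
        ≤ 9 * (m0sq ^ 2 * (ω x * (u x) ^ 2) + a ^ 2 * (ω x * ((blockProj N M *ᵥ u) x) ^ 2) + ω x * (lam x) ^ 2)
          + 3 * (16 * π ^ 4 * (d + 1)) ^ 2 * (ω x * (u x) ^ 2)
          + 12 * (d + 1) * ∑ ρ, π ^ 2 * (ω x * ((N : ℝ) * (u (x + unitVec (fine N M) ρ) - u x)) ^ 2) := by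
      intro x
      obtain ⟨hχω, hlapω, hDω⟩ := hletters x
      have heq := sq_lap_inv_le L hL ha hK N M hmsq hcap lam x
      rw [← hu] at heq
      have hωx := hω0 x
      have t1 : 3 * (χ x) ^ 2 * ((N : ℝ) ^ 2 * lapOp (fine N M) u x) ^ 2
          ≤ 9 * (m0sq ^ 2 * (ω x * (u x) ^ 2) + a ^ 2 * (ω x * ((blockProj N M *ᵥ u) x) ^ 2) + ω x * (lam x) ^ 2) := by
        have h13 := mul_le_mul hχω heq (sq_nonneg _) hωx
        calc 3 * (χ x) ^ 2 * ((N : ℝ) ^ 2 * lapOp (fine N M) u x) ^ 2 = 3 * ((χ x) ^ 2 * ((N : ℝ) ^ 2 * lapOp (fine N M) u x) ^ 2) := by ring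
          _ ≤ 3 * (ω x * (3 * (m0sq ^ 2 * (u x) ^ 2 + a ^ 2 * ((blockProj N M *ᵥ u) x) ^ 2 + (lam x) ^ 2))) :=
              mul_le_mul_of_nonneg_left h13 (by norm_num)
          _ = _ := by ring
      have t2 : 3 * (u x) ^ 2 * ((N : ℝ) ^ 2 * lapOp (fine N M) χ x) ^ 2 ≤ 3 * (16 * π ^ 4 * (d + 1)) ^ 2 * (ω x * (u x) ^ 2) := by
        have h3u : (0 : ℝ) ≤ 3 * (u x) ^ 2 := by positivity
        calc 3 * (u x) ^ 2 * ((N : ℝ) ^ 2 * lapOp (fine N M) χ x) ^ 2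
            ≤ 3 * (u x) ^ 2 * ((16 * π ^ 4 * (d + 1)) ^ 2 * ω x) := mul_le_mul_of_nonneg_left hlapω h3u
          _ = _ := by ring
      have t3 : ∑ ρ, ((N : ℝ) * (χ (x + unitVec (fine N M) ρ) - χ x)) ^ 2 * ((N : ℝ) * (u (x + unitVec (fine N M) ρ) - u x)) ^ 2
          ≤ ∑ ρ, π ^ 2 * (ω x * ((N : ℝ) * (u (x + unitVec (fine N M) ρ) - u x)) ^ 2) :=
        Finset.sum_le_sum fun ρ _ =>
          (mul_le_mul_of_nonneg_right (hDω ρ) (sq_nonneg ((N : ℝ) * (u (x + unitVec (fine N M) ρ) - u x)))).trans (le_of_eq (by ring))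
      have hd : (0 : ℝ) ≤ 12 * (d + 1) := by positivity
      exact add_le_add (add_le_add t1 t2) (mul_le_mul_of_nonneg_left t3 hd)
    refine (mul_le_mul_of_nonneg_left (Finset.sum_le_sum fun x _ => hpt x) (sq_nonneg _)).trans ?_
    -- STEP 5: the localised sums (all in the shape `X·e^{−δ_iD}²·S`)
    set E₁ : ℝ := Real.exp (-(δ₁ * D)) with hE₁
    set E₂ : ℝ := Real.exp (-(δ₂ * D)) with hE₂
    set E : ℝ := Real.exp (-(δ * D)) with hE
    have hE0 : 0 ≤ E := Real.exp_nonneg _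
    have hmono₁ : E₁ ^ 2 ≤ E ^ 2 :=
      pow_le_pow_left₀ (Real.exp_nonneg _) (Real.exp_le_exp.mpr (by have := mul_le_mul_of_nonneg_right hdle₁ hD; linarith)) 2
    have hmono₂ : E₂ ^ 2 ≤ E ^ 2 :=
      pow_le_pow_left₀ (Real.exp_nonneg _) (Real.exp_le_exp.mpr (by have := mul_le_mul_of_nonneg_right hdle₂ hD; linarith)) 2
    have hblock₁ : ∀ b'' : Tor M, ∑ x, (if blockOf N M x = b'' then (u x) ^ 2 else 0) ≤ (C₁ * Real.exp (-(δ₁ * tdistT M b'' b'))) ^ 2 * S := by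
      intro b''
      have h1 := H₁ K hK N hN e M hM msq hmsq hcap lam (fun x => if blockOf N M x = b'' then (1 : ℝ) else 0) 1 b'' b' zero_le_one
        (fun x => by split_ifs <;> norm_num) (fun x hx => by by_contra hne; exact hx (if_neg hne)) hsl
      rw [← hu, mul_one] at h1
      refine (le_of_eq ?_).trans h1
      exact Finset.sum_congr rfl fun x _ => by split_ifs <;> simp
    have hblock₂ : ∀ (ρ : Fin (d + 1)) (b'' : Tor M), ∑ x, (if blockOf N M x = b'' then ((N : ℝ) * (u (x + unitVec (fine N M) ρ) - u x)) ^ 2 else 0)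
        ≤ (C₂ * Real.exp (-(δ₂ * tdistT M b'' b'))) ^ 2 * S := by
      intro ρ b''
      have h1 := H₂ K hK N hN e M hM msq hmsq hcap ρ lam (fun x => if blockOf N M x = b'' then (1 : ℝ) else 0) 1 b'' b' zero_le_one
        (fun x => by split_ifs <;> norm_num) (fun x hx => by by_contra hne; exact hx (if_neg hne)) hsl
      rw [← hu, mul_one] at h1
      refine (le_of_eq ?_).trans h1
      exact Finset.sum_congr rfl fun x _ => by split_ifs <;> simp
    have hshape : ∀ (Ci δi Ei : ℝ), Ei = Real.exp (-(δi * D)) →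
        Real.exp 2 * latticeConst (d + 1) 1 * (Ci * Real.exp (2 * δi) * Real.exp (-(δi * tdistT M b b'))) ^ 2 * S
          = (Real.exp 2 * Λ₁ * (Ci * Real.exp (2 * δi)) ^ 2) * Ei ^ 2 * S := by
      intro Ci δi Ei hEi
      rw [hEi, hΛ₁, hDdef]; ring
    have hloc_u : ∑ x, (if tdistT M b (blockOf N M x) ≤ 2 then (u x) ^ 2 else 0) ≤ A₁ * E₁ ^ 2 * S := by
      have h := sum_nearBlocks_le N M u b b' hC₁.le hδ₁.le hS hblock₁
      rwa [hshape C₁ δ₁ E₁ hE₁] at h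
    have hloc_P : ∑ x, (if tdistT M b (blockOf N M x) ≤ 2 then ((blockProj N M *ᵥ u) x) ^ 2 else 0) ≤ A₁ * E₁ ^ 2 * S := by
      have h := sum_nearBlocks_le N M (fun x => (blockProj N M *ᵥ u) x) b b' hC₁.le hδ₁.le hS fun b'' =>
        (sum_block_sq_blockProj_le N M u b'').trans (hblock₁ b'')
      rwa [hshape C₁ δ₁ E₁ hE₁] at h
    have hloc_D : ∀ ρ : Fin (d + 1), ∑ x, (if tdistT M b (blockOf N M x) ≤ 2 then ((N : ℝ) * (u (x + unitVec (fine N M) ρ) - u x)) ^ 2 else 0)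
        ≤ A₂ * E₂ ^ 2 * S := by
      intro ρ
      have h := sum_nearBlocks_le N M (fun x => (N : ℝ) * (u (x + unitVec (fine N M) ρ) - u x)) b b' hC₂.le hδ₂.le hS (hblock₂ ρ)
      rwa [hshape C₂ δ₂ E₂ hE₂] at h
    have hloc_lam : ∑ x, ω x * (lam x) ^ 2 ≤ Real.exp (4 * δ) * E ^ 2 * S := by
      rw [hSdef, Finset.mul_sum]
      refine Finset.sum_le_sum fun x _ => ?_
      by_cases hlx : lam x = 0
      · rw [hlx]; simp
      · have hbx : blockOf N M x = b' := hsl x hlx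
        by_cases hnear : tdistT M b (blockOf N M x) ≤ 2
        · rw [hωdef]; dsimp only; rw [if_pos hnear, one_mul]
          rw [hbx] at hnear
          have h1 : 1 ≤ Real.exp (4 * δ) * E ^ 2 := by
            rw [hE, sq, ← Real.exp_add, ← Real.exp_add]
            refine Real.one_le_exp ?_
            have := mul_le_mul_of_nonneg_left hnear (by positivity : (0 : ℝ) ≤ 2 * δ)
            rw [hDdef]; linarith
          exact le_mul_of_one_le_left (sq_nonneg _) h1
        · rw [hωdef]; dsimp only; rw [if_neg hnear, zero_mul]; positivity
    -- rewrite the ω-weighted sums as indicator sums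
    have hωu : ∑ x, ω x * (u x) ^ 2 = ∑ x, (if tdistT M b (blockOf N M x) ≤ 2 then (u x) ^ 2 else 0) :=
      Finset.sum_congr rfl fun x _ => by rw [hωdef]; dsimp only; split_ifs <;> simp
    have hωP : ∑ x, ω x * ((blockProj N M *ᵥ u) x) ^ 2 = ∑ x, (if tdistT M b (blockOf N M x) ≤ 2 then ((blockProj N M *ᵥ u) x) ^ 2 else 0) :=
      Finset.sum_congr rfl fun x _ => by rw [hωdef]; dsimp only; split_ifs <;> simp
    have hωD : ∀ ρ, ∑ x, ω x * ((N : ℝ) * (u (x + unitVec (fine N M) ρ) - u x)) ^ 2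
        = ∑ x, (if tdistT M b (blockOf N M x) ≤ 2 then ((N : ℝ) * (u (x + unitVec (fine N M) ρ) - u x)) ^ 2 else 0) := fun ρ =>
      Finset.sum_congr rfl fun x _ => by rw [hωdef]; dsimp only; split_ifs <;> simp
    -- assemble
    have hsum : ∑ x, (9 * (m0sq ^ 2 * (ω x * (u x) ^ 2) + a ^ 2 * (ω x * ((blockProj N M *ᵥ u) x) ^ 2) + ω x * (lam x) ^ 2)
          + 3 * (16 * π ^ 4 * (d + 1)) ^ 2 * (ω x * (u x) ^ 2)
          + 12 * (d + 1) * ∑ ρ, π ^ 2 * (ω x * ((N : ℝ) * (u (x + unitVec (fine N M) ρ) - u x)) ^ 2))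
        = 9 * (m0sq ^ 2 * ∑ x, ω x * (u x) ^ 2 + a ^ 2 * ∑ x, ω x * ((blockProj N M *ᵥ u) x) ^ 2 + ∑ x, ω x * (lam x) ^ 2)
          + 3 * (16 * π ^ 4 * (d + 1)) ^ 2 * ∑ x, ω x * (u x) ^ 2
          + 12 * (d + 1) * ∑ ρ, π ^ 2 * ∑ x, ω x * ((N : ℝ) * (u (x + unitVec (fine N M) ρ) - u x)) ^ 2 := by
      simp only [Finset.sum_add_distrib, Finset.mul_sum, mul_add]
      congr 1
      rw [Finset.sum_comm]
    rw [hsum, hωu, hωP]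
    simp only [hωD]
    have hu' : A₁ * E₁ ^ 2 * S ≤ A₁ * E ^ 2 * S := mul_le_mul_of_nonneg_right (mul_le_mul_of_nonneg_left hmono₁ hA₁0) hS
    have hD' : A₂ * E₂ ^ 2 * S ≤ A₂ * E ^ 2 * S := mul_le_mul_of_nonneg_right (mul_le_mul_of_nonneg_left hmono₂ hA₂0) hS
    have hB1 : m0sq ^ 2 * ∑ x, (if tdistT M b (blockOf N M x) ≤ 2 then (u x) ^ 2 else 0) ≤ m0sq ^ 2 * (A₁ * E ^ 2 * S) :=
      mul_le_mul_of_nonneg_left (hloc_u.trans hu') (sq_nonneg _)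
    have hB2 : a ^ 2 * ∑ x, (if tdistT M b (blockOf N M x) ≤ 2 then ((blockProj N M *ᵥ u) x) ^ 2 else 0) ≤ a ^ 2 * (A₁ * E ^ 2 * S) :=
      mul_le_mul_of_nonneg_left (hloc_P.trans hu') (sq_nonneg _)
    have hB4 : 3 * (16 * π ^ 4 * (d + 1)) ^ 2 * ∑ x, (if tdistT M b (blockOf N M x) ≤ 2 then (u x) ^ 2 else 0)
        ≤ 3 * (16 * π ^ 4 * (d + 1)) ^ 2 * (A₁ * E ^ 2 * S) :=
      mul_le_mul_of_nonneg_left (hloc_u.trans hu') (by positivity)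
    have hB5 : ∑ ρ : Fin (d + 1), π ^ 2 * ∑ x, (if tdistT M b (blockOf N M x) ≤ 2 then ((N : ℝ) * (u (x + unitVec (fine N M) ρ) - u x)) ^ 2 else 0)
        ≤ (d + 1) * (π ^ 2 * (A₂ * E ^ 2 * S)) := by
      have hone : ∀ ρ ∈ (Finset.univ : Finset (Fin (d + 1))),
          π ^ 2 * ∑ x, (if tdistT M b (blockOf N M x) ≤ 2 then ((N : ℝ) * (u (x + unitVec (fine N M) ρ) - u x)) ^ 2 else 0)
            ≤ π ^ 2 * (A₂ * E ^ 2 * S) := fun ρ _ => mul_le_mul_of_nonneg_left ((hloc_D ρ).trans hD') (by positivity)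
      refine (Finset.sum_le_sum hone).trans (le_of_eq ?_)
      rw [Finset.sum_const, Finset.card_univ, Fintype.card_fin, nsmul_eq_mul]; push_cast; ring
    have hd0 : (0 : ℝ) ≤ 12 * (d + 1) := by positivity
    calc Hh ^ 2 * (9 * (m0sq ^ 2 * ∑ x, (if tdistT M b (blockOf N M x) ≤ 2 then (u x) ^ 2 else 0)
            + a ^ 2 * ∑ x, (if tdistT M b (blockOf N M x) ≤ 2 then ((blockProj N M *ᵥ u) x) ^ 2 else 0) + ∑ x, ω x * (lam x) ^ 2)
          + 3 * (16 * π ^ 4 * (d + 1)) ^ 2 * ∑ x, (if tdistT M b (blockOf N M x) ≤ 2 then (u x) ^ 2 else 0)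
          + 12 * (d + 1) * ∑ ρ, π ^ 2 * ∑ x, (if tdistT M b (blockOf N M x) ≤ 2 then ((N : ℝ) * (u (x + unitVec (fine N M) ρ) - u x)) ^ 2 else 0))
        ≤ Hh ^ 2 * (9 * (m0sq ^ 2 * (A₁ * E ^ 2 * S) + a ^ 2 * (A₁ * E ^ 2 * S) + Real.exp (4 * δ) * E ^ 2 * S)
          + 3 * (16 * π ^ 4 * (d + 1)) ^ 2 * (A₁ * E ^ 2 * S)
          + 12 * (d + 1) * ((d + 1) * (π ^ 2 * (A₂ * E ^ 2 * S)))) := by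
          refine mul_le_mul_of_nonneg_left ?_ (sq_nonneg _)
          exact add_le_add (add_le_add (mul_le_mul_of_nonneg_left (add_le_add (add_le_add hB1 hB2) hloc_lam) (by norm_num)) hB4)
            (mul_le_mul_of_nonneg_left hB5 hd0)
      _ = Hh ^ 2 * (B * E ^ 2 * S) := by rw [hB]; ring
      _ ≤ Hh ^ 2 * ((B + Bg) * E ^ 2 * S) := by
          refine mul_le_mul_of_nonneg_left ?_ (sq_nonneg _)
          exact mul_le_mul_of_nonneg_right (mul_le_mul_of_nonneg_right (le_add_of_nonneg_right hBg0) (sq_nonneg _)) hS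
      _ = (Real.sqrt (B + Bg) * Hh * E) ^ 2 * S := by rw [mul_pow, mul_pow, hExp]; ring
end Summit.QuantumFields.YangMills.BalabanUVNodes.N15KingModelRung.Curved

end
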